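import Literature.Probability.Percolation.CriticalContinuity
import Literature.Probability.Percolation.GrimmettMarstrand
import Literature.Probability.LatticeModels.IsoradialPercolation
import HarnessLib

/-!
# Runbook sanity lemmas — percolation definitions (REVIEW-RUNBOOK cards of the slab edge / primary programme)

Mechanical companions of the definition cards of
`REVIEW-RUNBOOK.md` for `percolationContinuity_of_noHeavyLowerTail` (slab cell) and for
`tripodExchange` / `oneCut_card_le_four` (primary programme), generated by
`harness/kit/review_runbook.py` (ops-runbook seat, human idea 2026-08-19):

* (a) AGREEMENT WITH MATHLIB: `bondPercolation G p` is literally Mathlib's product Bernoulli measure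
  `setBer(G.edgeSet, p)`; `openGraph ω` is Mathlib's `SimpleGraph.fromEdgeSet ω`; the inhomogeneous
  `prodBernoulli` with the constant parameter `p` on `u` and `0` off `u` is `setBer(u, p)`.
* (b) NON-VACUITY / SANITY OF THE PREDICATES: `theta ≡ 0` on a finite vertex type (tree lemma
  `theta_eq_zero_of_finite`, GrimmettMarstrand.lean), so `PercolationContinuity 0` holds for the degenerate lattice `ℤ⁰` — the theorem's side condition
  `2 ≤ d` is not idle bookkeeping), while `theta` is not identically zero: at `p = 1` on `ℤ^d`,
  `d ≥ 1`, the origin percolates almost surely (`theta (zdGraph d) 0 1 = 1`); the carriers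
  quantified over are inhabited.

Nothing here is used by the theorems under review; these are reader-facing checks.
-/

namespace Summit.CriticalPhenomena.PercolationContinuityZ3.Runbook

open Literature.Probability.Percolation Literature.Probability.LatticeModels MeasureTheory
open scoped ProbabilityTheory unitInterval

universe u

variable {V : Type u}

/-- (a) Our bond percolation measure is, by definition, Mathlib's product Bernoulli measure on the
edge set of the graph (`ProbabilityTheory.setBernoulli`). -/
theorem bondPercolation_eq_setBernoulli (G : SimpleGraph V) (p : unitInterval) :
    bondPercolation G p = setBer(G.edgeSet, p) := rfl

/-- (a) The open subgraph of a configuration is Mathlib's `SimpleGraph.fromEdgeSet`. -/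
theorem openGraph_eq_fromEdgeSet (ω : BondConfig V) :
    openGraph ω = SimpleGraph.fromEdgeSet ω := rfl

/-- (a) The event `{x ↔ y}` is reachability in the open subgraph (unfolding). -/
theorem mem_openConn_iff (ω : BondConfig V) (x y : V) :
    ω ∈ openConn x y ↔ (SimpleGraph.fromEdgeSet ω).Reachable x y := Iff.rfl

/-- (b, degenerate instance where the predicate HOLDS) `PercolationContinuity 0`: the lattice `ℤ⁰`
is a single site, so `θ(p) = 0` for every `p`, in particular at `p_c`.  (The reviewed theorems
assume `2 ≤ d`; `d = 0` holds vacuously and `d = 1` fails, see `theta_zdGraph_one`.) -/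
theorem percolationContinuity_zero : PercolationContinuity 0 :=
  Literature.Probability.Percolation.theta_eq_zero_of_finite _ _ _

/-- (b, degenerate instance) and the critical probability of `ℤ⁰` is `1` by the `∪ {1}` convention of
`criticalProb` (tree lemma `criticalProb_eq_one_of_finite`). -/
theorem criticalProb_zdGraph_zero : criticalProb (zdGraph 0) (0 : Site 0) = 1 :=
  Literature.Probability.Percolation.criticalProb_eq_one_of_finite _ _

/-- (b) `θ` is not identically zero: if every vertex is reachable from `x` in `G` and the vertex
type is infinite, then at edge density `1` the origin percolates almost surely, `θ_x(1) = 1`. -/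
theorem theta_one_eq_one_of_reachable [Infinite V] (G : SimpleGraph V) (x : V)
    (h : ∀ y, G.Reachable x y) : theta G x 1 = 1 := by
  have hmem : G.edgeSet ∈ percolatesAt (V := V) x := by
    show (openCluster G.edgeSet x).Infinite
    have hc : openCluster G.edgeSet x = Set.univ := by
      ext y
      simp only [openCluster, openGraph, SimpleGraph.fromEdgeSet_edgeSet, Set.mem_setOf_eq,
        Set.mem_univ, iff_true]
      exact h y
    rw [hc]
    exact Set.infinite_univ
  rw [theta, bondPercolation_eq_setBernoulli, ProbabilityTheory.setBernoulli_one, measureReal_def,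
    Measure.dirac_apply_of_mem hmem, ENNReal.toReal_one]

/-- (b) For `d ≥ 1` the lattice `ℤ^d` has infinitely many sites. -/
theorem infinite_site (d : ℕ) (hd : 1 ≤ d) : Infinite (Site d) := by
  haveI : Nonempty (Fin d) := ⟨⟨0, hd⟩⟩
  exact Infinite.of_injective (fun n : ℤ => fun _ : Fin d => n)
    (fun a b hab => by simpa using congrFun hab (Classical.arbitrary (Fin d)))

/-- (b, instance where the ingredients are NON-TRIVIAL) On `ℤ^d`, `d ≥ 1`, at edge density `1` the
origin lies in an infinite open cluster almost surely: `θ_{ℤ^d}(1) = 1` (all edges open, `ℤ^d`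
connected — tree theorem `zdGraph_reachable` — and infinite). -/
theorem theta_zdGraph_one (d : ℕ) (hd : 1 ≤ d) : theta (zdGraph d) (0 : Site d) 1 = 1 := by
  haveI := infinite_site d hd
  exact theta_one_eq_one_of_reachable _ _ (zdGraph_reachable 0)

/-- (b) The carrier `Site d = (Fin d → ℤ)` of the lattice is inhabited (the origin). -/
theorem nonempty_site (d : ℕ) : Nonempty (Site d) := ⟨0⟩

/-- (b) Bond configurations exist on every vertex type (the empty configuration). -/
theorem nonempty_bondConfig (W : Type u) : Nonempty (BondConfig W) := ⟨(∅ : Set (Sym2 W))⟩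

/-- (b) Edge-weight functions `Sym2 (Fin n) → [0,1]`, the objects `NoHeavyLowerTail` and the tripod
inequality quantify over, exist (instance synthesis; the constant weight `0`). -/
theorem nonempty_weights (n : ℕ) : Nonempty (Sym2 (Fin n) → unitInterval) := inferInstance

/-- (a) AGREEMENT WITH MATHLIB for the inhomogeneous product measure: `prodBernoulli` with the
constant parameter `p` on `u` and parameter `0` off `u` is Mathlib's `setBer(u, p)` (the docstring
of `prodBernoulli` claims exactly this special case). -/
theorem prodBernoulli_ite_eq_setBernoulli {ι : Type u} (u : Set ι) [DecidablePred (· ∈ u)]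
    (p : unitInterval) : prodBernoulli (fun i => if i ∈ u then p else 0) = setBer(u, p) := by
  unfold prodBernoulli ProbabilityTheory.setBernoulli
  congr 1
  congr 1
  funext i
  by_cases hi : i ∈ u
  · simp [hi]
  · simp only [hi, if_false]
    rw [← add_smul, unitInterval.toNNReal_add_toNNReal_symm, one_smul, unitInterval.toNNReal_zero,
      zero_smul, zero_add, unitInterval.symm_zero, unitInterval.toNNReal_one, one_smul]

/-- (a) In particular bond percolation on `G` with density `p` is the inhomogeneous product measure
with weight `p` on the edges of `G` and `0` elsewhere — the form in which the engine statements
(`NoHeavyLowerTail`, the tripod inequality) are phrased (`prodBernoulli w`, arbitrary weights `w`). -/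
theorem bondPercolation_eq_prodBernoulli (G : SimpleGraph V) [DecidablePred (· ∈ G.edgeSet)]
    (p : unitInterval) : bondPercolation G p = prodBernoulli (fun e => if e ∈ G.edgeSet then p else 0) :=
  (prodBernoulli_ite_eq_setBernoulli G.edgeSet p).symm

end Summit.CriticalPhenomena.PercolationContinuityZ3.Runbook
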